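import Literature.Analysis.FunctionSpaces.TorusClassicalNSConcatenation
import HarnessLib

/-!
# Classical Navier–Stokes solutions on the flat torus: locality on a general time set and
# exhaustion of a half-line by nested compact windows

Function-space support file (all results proved; no definitions, no named facts) for the accepted
notion `Torus.IsClassicalNSSolutionOn S ν f u p` of `TorusFluidGlue`, continuing
`TorusClassicalNSRestart` (`of_local`: locality in time on an OPEN time set) and
`TorusClassicalNSGluing` (`pressure_sub_eq_of_eventuallyEq`: the velocity determines the normalised
pressure at INTERIOR times).  The half-line `Ici a` of semiflows is not open, and the restart-and-continue
construction of GLOBAL solutions produces solutions on the nested compact windows `Icc a bₘ`, `bₘ → ∞`;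
this file supplies the bookkeeping that turns them into one classical solution on `Ici a`:

* `Torus.IsClassicalNSSolutionOn.of_local_inter` — locality in time on an ARBITRARY time set `S`: if every
  `t ∈ S` has an open neighbourhood `O` such that `(u, p)` agrees on `S ∩ O` with a classical solution on
  `S ∩ O`, then `(u, p)` is classical on `S` (joint smoothness is local, Mathlib
  `contDiffOn_of_locally_contDiffOn`; the one-sided time derivative within `S` at `t` only sees `S ∩ O`,
  Mathlib `derivWithin_inter`);
* `Torus.IsClassicalNSSolutionOn.gradient_pressure_eq_of_eqOn_inter`,
  `Torus.IsClassicalNSSolutionOn.pressure_sub_eq_of_eqOn_inter` — the velocity determines the pressure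
  gradient, hence the pressure up to a function of time, ALSO AT BOUNDARY TIMES: it suffices that the two
  time sets agree near `t` (`S₁ ∩ O = S₂ ∩ O`) and the velocities agree on `S₁ ∩ O`;
* `Torus.IsClassicalNSSolutionOn.exists_of_forall_nat` — **exhaustion**: classical solutions `(uₘ, pₘ)` on
  `Icc a bₘ` (`bₘ → ∞`, `ν ≥ 0`, same force) with a common value at time `a` assemble to a classical
  solution `(U, P)` on `Ici a` with `U = uₘ` on `Icc a bₘ` for every `m` (velocities agree on the overlaps
  by forward uniqueness `velocity_unique`; pressures are normalised at a base point).

Tree search (`lean search 'of_local|glue_Ioi|glue_Icc|concat_schedule'`): locality / gluing only on open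
sets or for two closed windows; nothing for `Ici`.  Mathlib: `contDiffOn_of_locally_contDiffOn`,
`derivWithin_inter`, `derivWithin_congr`, `inter_mem_nhdsWithin`, `Nat.find`.

## References

* J. C. Robinson, J. L. Rodrigo, W. Sadowski, *The Three-Dimensional Navier–Stokes Equations.
  Classical Theory*, CUP 2016, §6.3 and §8.1 (restart, identify on the overlap, continue).
  [RobinsonRodrigoSadowskiCUP2016]
* A. J. Majda, A. L. Bertozzi, *Vorticity and Incompressible Flow*, CUP 2002, §3.2.3, Cor. 3.1.
-/

open MeasureTheory Set Filter
open _root_.Topology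
open scoped InnerProductSpace ContDiff

noncomputable section

namespace Literature.Analysis.FunctionSpaces

namespace Torus

variable {d : Type*} [Fintype d] [DecidableEq d]

/-! ## Locality in time on a general time set -/

section Local

variable {ν : ℝ} {f : ℝ → UnitAddTorus d → EuclideanSpace ℝ d}

/-- **Classical solutions are local in time (general time set).** Let `S` be any time set and `(u, p)`
a pair of fields such that every `t ∈ S` has an open neighbourhood `O` carrying a classical solution
`(u', p')` on `S ∩ O` (same viscosity and force) with `u' = u`, `p' = p` on `S ∩ O`. Then `(u, p)` is a
classical solution on `S`: joint smoothness on `S × T^d` is a local property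
(`contDiffOn_of_locally_contDiffOn`), and at `t ∈ S ∩ O` the time derivative within `S` equals the one
within `S ∩ O` (`derivWithin_inter`), which only sees the field on `S ∩ O`. [folklore] -/
theorem IsClassicalNSSolutionOn.of_local_inter {S : Set ℝ}
    {u : ℝ → UnitAddTorus d → EuclideanSpace ℝ d} {p : ℝ → UnitAddTorus d → ℝ}
    (h : ∀ t ∈ S, ∃ O : Set ℝ, IsOpen O ∧ t ∈ O ∧
      ∃ (u' : ℝ → UnitAddTorus d → EuclideanSpace ℝ d) (p' : ℝ → UnitAddTorus d → ℝ),
        IsClassicalNSSolutionOn (S ∩ O) ν f u' p' ∧ (∀ s ∈ S ∩ O, u' s = u s) ∧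
          (∀ s ∈ S ∩ O, p' s = p s)) :
    IsClassicalNSSolutionOn S ν f u p := by
  have hset : ∀ O : Set ℝ,
      (S ×ˢ (univ : Set (EuclideanSpace ℝ d))) ∩ O ×ˢ univ = (S ∩ O) ×ˢ univ := fun O => by
    rw [prod_inter_prod, inter_self]
  refine ⟨?_, ?_, fun t ht x => ?_, fun t ht => ?_⟩
  · refine contDiffOn_of_locally_contDiffOn fun z hz => ?_
    obtain ⟨t, y⟩ := z
    obtain ⟨O, hO, htO, u', p', h', hu', -⟩ := h t (mem_prod.1 hz).1
    refine ⟨O ×ˢ univ, hO.prod isOpen_univ, ⟨htO, mem_univ _⟩, ?_⟩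
    rw [hset O]
    exact h'.smooth_velocity.congr fun z hz => by
      obtain ⟨τ, y'⟩ := z
      simp only [stLift_apply, hu' τ (mem_prod.1 hz).1]
  · refine contDiffOn_of_locally_contDiffOn fun z hz => ?_
    obtain ⟨t, y⟩ := z
    obtain ⟨O, hO, htO, u', p', h', -, hp'⟩ := h t (mem_prod.1 hz).1
    refine ⟨O ×ˢ univ, hO.prod isOpen_univ, ⟨htO, mem_univ _⟩, ?_⟩
    rw [hset O]
    exact h'.smooth_pressure.congr fun z hz => by
      obtain ⟨τ, y'⟩ := z
      simp only [stLift_apply, hp' τ (mem_prod.1 hz).1]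
  · obtain ⟨O, hO, htO, u', p', h', hu', hp'⟩ := h t ht
    have htO' : t ∈ S ∩ O := ⟨ht, htO⟩
    have hD : timeDerivWithin S u t x = timeDerivWithin (S ∩ O) u' t x := by
      simp only [timeDerivWithin]
      rw [derivWithin_inter (hO.mem_nhds htO)]
      refine (Filter.EventuallyEq.derivWithin_eq ?_ ?_).symm
      · filter_upwards [inter_mem_nhdsWithin S (hO.mem_nhds htO)] with τ hτ
        rw [hu' τ hτ]
      · rw [hu' t htO']
    rw [hD, ← hu' t htO', ← hp' t htO']
    exact h'.momentum t htO' x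
  · obtain ⟨O, -, htO, u', p', h', hu', -⟩ := h t ht
    rw [← hu' t ⟨ht, htO⟩]
    exact h'.divFree t ⟨ht, htO⟩

/-! ## The velocity determines the pressure, also at boundary times -/

/-- **The velocity determines the pressure gradient (boundary-capable form).** Let `(u₁, p₁)` be
classical on `S₁` and `(u₂, p₂)` on `S₂` (same viscosity and force), let `O` be an open neighbourhood
of `t ∈ S₁` on which the time sets agree, `S₁ ∩ O = S₂ ∩ O`, and suppose `u₁ = u₂` on `S₁ ∩ O`. Then
`∇p₁(t, ·) = ∇p₂(t, ·)`: the one-sided time derivatives within `S₁`, `S₂` at `t` are those within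
`S₁ ∩ O = S₂ ∩ O` (`derivWithin_inter`), where the velocities agree (`derivWithin_congr`); subtract the
momentum equations. Unlike `gradient_pressure_eq_of_eventuallyEq`, `t` may be an endpoint of both
time sets (e.g. `S₁ = Icc a b`, `S₂ = Icc a b'`, `t = a`). [folklore] -/
theorem IsClassicalNSSolutionOn.gradient_pressure_eq_of_eqOn_inter {S₁ S₂ O : Set ℝ}
    {u₁ u₂ : ℝ → UnitAddTorus d → EuclideanSpace ℝ d} {p₁ p₂ : ℝ → UnitAddTorus d → ℝ}
    (h₁ : IsClassicalNSSolutionOn S₁ ν f u₁ p₁) (h₂ : IsClassicalNSSolutionOn S₂ ν f u₂ p₂)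
    (hO : IsOpen O) {t : ℝ} (htO : t ∈ O) (ht₁ : t ∈ S₁) (hS : S₁ ∩ O = S₂ ∩ O)
    (heq : ∀ τ ∈ S₁ ∩ O, u₁ τ = u₂ τ) (x : UnitAddTorus d) :
    gradient (p₁ t) x = gradient (p₂ t) x := by
  have ht₂ : t ∈ S₂ := by
    have h : t ∈ S₁ ∩ O := ⟨ht₁, htO⟩
    rw [hS] at h
    exact h.1
  have heqt : u₁ t = u₂ t := heq t ⟨ht₁, htO⟩
  have hd : timeDerivWithin S₁ u₁ t x = timeDerivWithin S₂ u₂ t x := by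
    simp only [timeDerivWithin]
    rw [← derivWithin_inter (s := S₁) (hO.mem_nhds htO), ← derivWithin_inter (s := S₂) (hO.mem_nhds htO),
      ← hS]
    exact derivWithin_congr (fun τ hτ => congrFun (heq τ hτ) x) (congrFun heqt x)
  have hm₁ := h₁.momentum t ht₁ x
  have hm₂ := h₂.momentum t ht₂ x
  rw [hd, heqt] at hm₁
  have h12 := hm₁.symm.trans hm₂
  simpa using h12

/-- **Pressures with the same velocity differ by a function of time (boundary-capable form).** Under
the hypotheses of `gradient_pressure_eq_of_eqOn_inter`, `p₁(t, x) − p₁(t, x₀) = p₂(t, x) − p₂(t, x₀)`: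
the lift of `p₁(t) − p₂(t)` has vanishing derivative, hence is constant (Mathlib
`is_const_of_fderiv_eq_zero`; same argument as `pressure_sub_eq_of_eventuallyEq`). [folklore] -/
theorem IsClassicalNSSolutionOn.pressure_sub_eq_of_eqOn_inter {S₁ S₂ O : Set ℝ}
    {u₁ u₂ : ℝ → UnitAddTorus d → EuclideanSpace ℝ d} {p₁ p₂ : ℝ → UnitAddTorus d → ℝ}
    (h₁ : IsClassicalNSSolutionOn S₁ ν f u₁ p₁) (h₂ : IsClassicalNSSolutionOn S₂ ν f u₂ p₂)
    (hO : IsOpen O) {t : ℝ} (htO : t ∈ O) (ht₁ : t ∈ S₁) (hS : S₁ ∩ O = S₂ ∩ O)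
    (heq : ∀ τ ∈ S₁ ∩ O, u₁ τ = u₂ τ) (x x₀ : UnitAddTorus d) :
    p₁ t x - p₁ t x₀ = p₂ t x - p₂ t x₀ := by
  have ht₂ : t ∈ S₂ := by
    have h : t ∈ S₁ ∩ O := ⟨ht₁, htO⟩
    rw [hS] at h
    exact h.1
  have hp₁ : IsSmooth (p₁ t) := h₁.smooth_pressure.isSmooth_slice ht₁
  have hp₂ : IsSmooth (p₂ t) := h₂.smooth_pressure.isSmooth_slice ht₂
  have hψ : IsSmooth (p₁ t - p₂ t) := hp₁.sub hp₂
  have hg0 : ∀ y, Torus.gradient (p₁ t - p₂ t) y = 0 := fun y => by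
    rw [gradient_sub (hp₁.isContDiff (by simp)) (hp₂.isContDiff (by simp)),
      h₁.gradient_pressure_eq_of_eqOn_inter h₂ hO htO ht₁ hS heq y, sub_self]
  have hD : Differentiable ℝ (lift (p₁ t - p₂ t)) := ContDiff.differentiable hψ (by simp)
  have hzero : ∀ y, _root_.fderiv ℝ (lift (p₁ t - p₂ t)) y = 0 := fun y => by
    rw [fderiv_lift]
    ext w
    rw [← inner_gradient_left, hg0]
    simp
  have hc := is_const_of_fderiv_eq_zero hD hzero (repr x) (repr x₀)
  rw [lift_repr, lift_repr, Pi.sub_apply, Pi.sub_apply] at hc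
  linarith

end Local

/-! ## Exhaustion of a half-line by nested compact windows -/

section Exhaustion

variable {ν : ℝ} {f : ℝ → UnitAddTorus d → EuclideanSpace ℝ d}

/-- **Exhaustion.** Let `(uₘ, pₘ)`, `m ∈ ℕ`, be classical solutions of NS_ν(f), `ν ≥ 0`, on the windows
`[a, bₘ] × T^d` with `bₘ → ∞`, all with the same value at time `a`. Then there is a
classical solution `(U, P)` on `[a, ∞) × T^d` with `U = uₘ` on `[a, bₘ]` for every `m`. Proof: by
forward uniqueness (`velocity_unique`) the velocities agree on the overlaps `[a, min bₘ bₘ']`; put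
`U(t) = u_{N(t)}(t)` with `N(t)` the first index with `b_{N(t)} ≥ t + 1` (Mathlib `Nat.find`) and
`P` the pressure `p_{N(t)}` normalised at a base point; near `t ≥ a` the pair agrees on
`[a, ∞) ∩ (−∞, t + 1) = [a, t + 1)` with `(u_{N(t)}, p_{N(t)} − p_{N(t)}(·, x₀))`, the normalised
pressures of two indices agreeing wherever both windows reach (`pressure_sub_eq_of_eqOn_inter`), so
`of_local_inter` applies (Robinson–Rodrigo–Sadowski 2016, §8.1). [folklore] -/
theorem IsClassicalNSSolutionOn.exists_of_forall_nat (hν : 0 ≤ ν) {a : ℝ} {b : ℕ → ℝ}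
    (htop : Tendsto b atTop atTop)
    {u : ℕ → ℝ → UnitAddTorus d → EuclideanSpace ℝ d} {p : ℕ → ℝ → UnitAddTorus d → ℝ}
    (hu : ∀ m, IsClassicalNSSolutionOn (Icc a (b m)) ν f (u m) (p m)) (h0 : ∀ m, u m a = u 0 a) :
    ∃ (U : ℝ → UnitAddTorus d → EuclideanSpace ℝ d) (P : ℝ → UnitAddTorus d → ℝ),
      IsClassicalNSSolutionOn (Ici a) ν f U P ∧ ∀ m, ∀ t ∈ Icc a (b m), U t = u m t := by
  classical
  -- consistency of the velocities on the overlaps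
  have hcons : ∀ (m m' : ℕ) (t : ℝ), t ∈ Icc a (b m) → t ≤ b m' → u m t = u m' t := by
    intro m m' t ht ht'
    rcases eq_or_lt_of_le ht.1 with hta | hat
    · rw [← hta, h0 m, h0 m']
    · have hsub : Icc a t ⊆ Icc a (b m) := Icc_subset_Icc le_rfl ht.2
      have hsub' : Icc a t ⊆ Icc a (b m') := Icc_subset_Icc le_rfl ht'
      exact ((hu m).mono hsub (uniqueDiffOn_Icc hat)).velocity_unique hν
        ((hu m').mono hsub' (uniqueDiffOn_Icc hat)) (by rw [h0 m, h0 m']) ⟨hat.le, le_rfl⟩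
  -- the index of a time
  have hex : ∀ t : ℝ, ∃ m : ℕ, t + 1 ≤ b m := fun t =>
    (htop.eventually (eventually_ge_atTop (t + 1))).exists
  set N : ℝ → ℕ := fun t => Nat.find (hex t) with hN
  have hNspec : ∀ t, t + 1 ≤ b (N t) := fun t => Nat.find_spec (hex t)
  set x₀ : UnitAddTorus d := 0
  refine ⟨fun t => u (N t) t, fun t x => p (N t) t x - p (N t) t x₀, ?_, fun m t ht => ?_⟩
  · refine IsClassicalNSSolutionOn.of_local_inter fun t ht => ?_
    refine ⟨Iio (t + 1), isOpen_Iio, by simp, u (N t), fun s x => p (N t) s x - p (N t) s x₀, ?_,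
      fun s hs => ?_, fun s hs => ?_⟩
    · rw [Ici_inter_Iio]
      exact ((hu (N t)).mono (fun s hs => ⟨hs.1, hs.2.le.trans (hNspec t)⟩)
        (uniqueDiffOn_Ico a (t + 1))).sub_pressure_apply x₀
    · rw [Ici_inter_Iio] at hs
      exact hcons (N t) (N s) s ⟨hs.1, hs.2.le.trans (hNspec t)⟩ (by linarith [hNspec s])
    · rw [Ici_inter_Iio] at hs
      funext x
      show p (N t) s x - p (N t) s x₀ = p (N s) s x - p (N s) s x₀
      have hsO : s ∈ Iio (min (b (N t)) (b (N s))) :=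
        lt_min (hs.2.trans_le (hNspec t)) (by linarith [hNspec s])
      have hS : Icc a (b (N t)) ∩ Iio (min (b (N t)) (b (N s))) =
          Icc a (b (N s)) ∩ Iio (min (b (N t)) (b (N s))) := by
        ext τ
        simp only [mem_inter_iff, mem_Icc, mem_Iio, lt_min_iff]
        constructor
        · rintro ⟨⟨h1, -⟩, h3, h4⟩
          exact ⟨⟨h1, h4.le⟩, h3, h4⟩
        · rintro ⟨⟨h1, -⟩, h3, h4⟩
          exact ⟨⟨h1, h3.le⟩, h3, h4⟩
      exact (hu (N t)).pressure_sub_eq_of_eqOn_inter (hu (N s)) isOpen_Iio hsO ⟨hs.1, hs.2.le.trans (hNspec t)⟩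
        hS (fun τ hτ => hcons (N t) (N s) τ hτ.1 (lt_min_iff.1 hτ.2).2.le) x x₀
  · exact hcons (N t) m t ⟨ht.1, by linarith [hNspec t]⟩ ht.2

end Exhaustion

end Torus

end Literature.Analysis.FunctionSpaces

end
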